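import Literature.NumberTheory.EllipticCurves.HeegnerPointsKolyvaginVisibleDescentPairExactProofs
import HarnessLib

/-!
# EXACTNESS for a VISIBLE PAIR `(E, E^D)` over `ℚ` from a deep depth-one certificate — value formula on
# `p^{2M₀}`-torsion classes only

Companion of `HeegnerPointsKolyvaginVisibleDescentPairExactProofs`
(`KolyvaginDescent.VisiblePairHypothesesM.sel₁_eq_and_card_sel₂_eq_of_primitive`): the SAME theorem with the
Cassels–Tate value formula `hCTV` assumed only for classes `t` with `p^{2M₀} t = 0` — the only classes the
telescope applies it to (`VisibleSplitHypothesesM.exists_chain_of_casselsTate_of_torsion`: Selmer eigenclasses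
independent of `x`, killed by `p^{2M₀}` by Claims A/B), and the form in which the Cassels–Tate pairings of the two
members pulled back to `Sel₁`, `Sel₂` actually satisfy it (a class with a large `x`-component has the same image in
`Ш` as a small one but other local orders).  Written by the BSD route `GenusKolyvaginAtTwo` (seat `bsd-line-gk2-p2`
g12) in a separate theorems-only file (the sibling declares `fstSel`, `sndSel`, `prodPairing`).  Pure algebra; no
named fact; nothing here is a claim about BSD.

## References

* W. G. McCallum, *Kolyvagin's work on Shafarevich–Tate groups*, LMS LNS 153 (1991): §2 (1),
  Thm. 5.4, Cor. 5.6. [McCallumLMS1991]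
* V. A. Kolyvagin, Izv. 1989, Thm. `B_l` (l = 2), §3. [Kolyvagin1989Izv]
-/

open scoped Classical

namespace Literature.NumberTheory.EllipticCurves

namespace KolyvaginDescent

namespace VisiblePairHypothesesM

variable {V₁ V₂ : Type*} [AddCommGroup V₁] [AddCommGroup V₂] {Pl : Type*}
variable {H : Type*} [AddCommGroup H] (S : VisiblePairHypothesesM V₁ V₂ Pl H)

/-! ### Plumbing (restated for this file) -/

/-- Unfolding `prodPairing`: `P((z₁,z₂),(t₁,t₂)) = P₁(z₁,t₁) + P₂(z₂,t₂)`.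
[cite: McCallumLMS1991, §2 (1)] -/
private theorem prodPairing_apply' {R : Type*} [AddCommGroup R] (P₁ : S.Sel₁ →+ S.Sel₁ →+ R)
    (P₂ : S.Sel₂ →+ S.Sel₂ →+ R) (z t : S.toVisibleSplit.Sel) :
    S.prodPairing P₁ P₂ z t = P₁ (S.fstSel z) (S.fstSel t) + P₂ (S.sndSel z) (S.sndSel t) := rfl

/-- `v ∈ V^{(1)} ↔ v.2 = 0`. [folklore] -/
private theorem mem_part_one' {v : V₁ × V₂} : v ∈ S.toVisibleSplit.part 1 ↔ v.2 = 0 := by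
  change v ∈ pairEig V₁ V₂ 1 ↔ _
  simp [pairEig, AddSubgroup.mem_prod]

/-- `v ∈ V^{(-1)} ↔ v.1 = 0`. [folklore] -/
private theorem mem_part_neg_one' {v : V₁ × V₂} : v ∈ S.toVisibleSplit.part (-1) ↔ v.1 = 0 := by
  change v ∈ pairEig V₁ V₂ (-1) ↔ _
  simp [pairEig, AddSubgroup.mem_prod]

/-! ### Exactness for the pair, value formula on `p^{2M₀}`-torsion classes -/

/-- **Exactness for a VISIBLE pair from a deep depth-one certificate, value formula on `p^{2M₀}`-torsion
classes only.** As `sel₁_eq_and_card_sel₂_eq_of_primitive`, with the restricted `hCTV`.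
[cite: McCallumLMS1991, Thm. 5.4, Cor. 5.6 (case M₁ = 0)] [cite: Kolyvagin1989Izv, §3] -/
theorem sel₁_eq_and_card_sel₂_eq_of_primitive_of_torsion [Finite S.Sel₁] [Finite S.Sel₂]
    (P₁ : S.Sel₁ →+ S.Sel₁ →+ AddCircle (1 : ℚ)) (halt₁ : ∀ z, P₁ z z = 0)
    (hPx : ∀ t, P₁ ⟨S.x, S.x_mem⟩ t = 0)
    (hnd₁ : ∀ z : S.Sel₁, (∀ t, P₁ z t = 0) → (z : V₁) ∈ AddSubgroup.zmultiples S.x)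
    (P₂ : S.Sel₂ →+ S.Sel₂ →+ AddCircle (1 : ℚ)) (halt₂ : ∀ z, P₂ z z = 0)
    (hnd₂ : ∀ z : S.Sel₂, (∀ t, P₂ z t = 0) → z = 0)
    (hCTV : ∀ ℓ m : ℕ, S.Kol ℓ → KolSupp S.Kol (ℓ * m) → ¬ ℓ ∣ m →
      ∀ (j N a b : ℕ) (t : V₁ × V₂) (ht : t ∈ S.toVisibleSplit.Sel)
        (hz : ((S.p : ℤ) ^ j) • S.toVisibleSplit.c (ℓ * m) ∈ S.toVisibleSplit.Sel),
      ((S.p : ℤ) ^ N) • t = 0 → ((S.p : ℤ) ^ (2 * S.M₀)) • t = 0 →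
      t ∈ S.toVisibleSplit.part (1 * (-1) ^ (ℓ * m).primeFactors.card) →
      (∀ q ∈ m.primeFactors, t ∈ S.toVisibleSplit.A q) → S.M - S.M₀ ≤ j → N + S.M₀ ≤ S.M → N ≤ j →
      a + b + 1 = N → ((S.p : ℤ) ^ (a + (j - N))) • S.toVisibleSplit.c m ∉ S.toVisibleSplit.A ℓ →
      ((S.p : ℤ) ^ b) • t ∉ S.toVisibleSplit.A ℓ →
      S.prodPairing P₁ P₂ ⟨_, hz⟩ ⟨t, ht⟩ ≠ 0)
    (hCeb : ∀ (T : Finset (V₁ × V₂)) (g₁ g₂ : V₁ × V₂) (ν : ℤ), (ν = 1 ∨ ν = -1) →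
      g₁ ∈ S.toVisibleSplit.part ν → g₂ ∈ S.toVisibleSplit.part (-ν) →
      (∀ t ∈ T, ∃ e : ℤ, (e = 1 ∨ e = -1) ∧ t ∈ S.toVisibleSplit.part e) →
      (∀ g ∈ AddSubgroup.closure (insert g₁ (insert g₂ (T : Set (V₁ × V₂)))),
        S.rK₁ g.1 + S.rK₂ g.2 = 0 → g = 0) →
      ∀ b : ℕ, ∃ ℓ, b < ℓ ∧ S.Kol ℓ ∧ (∀ t ∈ T, t ∈ (S.A₁ ℓ).prod (S.A₂ ℓ)) ∧
        (∀ j : ℕ, ((S.p : ℤ) ^ j) • g₁ ∈ (S.A₁ ℓ).prod (S.A₂ ℓ) ↔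
          ((S.p : ℤ) ^ j) • g₁ ∈ AddSubgroup.closure (T : Set (V₁ × V₂))) ∧
        (∀ j : ℕ, ((S.p : ℤ) ^ j) • g₂ ∈ (S.A₁ ℓ).prod (S.A₂ ℓ) ↔
          ((S.p : ℤ) ^ j) • g₂ ∈ AddSubgroup.closure (T : Set (V₁ × V₂))))
    (hcsupp₁ : ∀ n, KolSupp S.Kol n → Even n.primeFactors.card →
      ∀ v, (∀ q, S.Kol q → v ≠ S.pl q) → S.c₁ n ∈ S.Loc₁ v)
    (hcsupp₂ : ∀ n, KolSupp S.Kol n → Odd n.primeFactors.card →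
      ∀ v, (∀ q, S.Kol q → v ≠ S.pl q) → S.c₂ n ∈ S.Loc₂ v)
    (h3 : 3 * S.M₀ ≤ S.M)
    {ℓ₀ : ℕ} (hℓ₀ : S.Kol ℓ₀) (hc₀ : ((S.p : ℤ) ^ (S.M - 1)) • S.c₂ ℓ₀ ≠ 0) :
    S.Sel₁ = AddSubgroup.zmultiples S.x ∧ Nat.card S.Sel₂ = S.p ^ (2 * S.M₀) := by
  -- finiteness of `Sel₁ × Sel₂`
  haveI : Finite S.toVisibleSplit.Sel := by
    change Finite (S.Sel₁.prod S.Sel₂)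
    exact Finite.of_equiv _ (AddSubgroup.prodEquiv S.Sel₁ S.Sel₂).toEquiv.symm
  set P := S.prodPairing P₁ P₂ with hP
  -- the split inputs
  have halt : ∀ z, P z z = 0 := fun z ↦ by rw [hP, prodPairing_apply', halt₁, halt₂, add_zero]
  have hPcross : ∀ z t : S.toVisibleSplit.Sel, (z : V₁ × V₂) ∈ S.toVisibleSplit.part S.toVisibleSplit.ε →
      (t : V₁ × V₂) ∈ S.toVisibleSplit.part (-S.toVisibleSplit.ε) → P z t = 0 := by
    intro z t hz ht
    change (z : V₁ × V₂) ∈ S.toVisibleSplit.part 1 at hz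
    change (t : V₁ × V₂) ∈ S.toVisibleSplit.part (-1) at ht
    have hz2 : S.sndSel z = 0 := Subtype.ext (S.mem_part_one'.mp hz)
    have ht1 : S.fstSel t = 0 := Subtype.ext (S.mem_part_neg_one'.mp ht)
    rw [hP, prodPairing_apply', hz2, ht1, map_zero, map_zero, AddMonoidHom.zero_apply, zero_add]
  have hx : (⟨S.toVisibleSplit.x, S.toVisibleSplit.x_mem⟩ : S.toVisibleSplit.Sel) =
      ⟨(S.x, 0), AddSubgroup.mem_prod.mpr ⟨S.x_mem, S.Sel₂.zero_mem⟩⟩ := rfl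
  have hPx' : ∀ t, P ⟨S.toVisibleSplit.x, S.toVisibleSplit.x_mem⟩ t = 0 := by
    intro t
    rw [hP, prodPairing_apply']
    have h1 : S.fstSel ⟨S.toVisibleSplit.x, S.toVisibleSplit.x_mem⟩ = ⟨S.x, S.x_mem⟩ := Subtype.ext rfl
    have h2 : S.sndSel ⟨S.toVisibleSplit.x, S.toVisibleSplit.x_mem⟩ = 0 := Subtype.ext rfl
    rw [h1, h2, hPx, map_zero, AddMonoidHom.zero_apply, add_zero]
  have hnd : ∀ z : S.toVisibleSplit.Sel, (∀ t, P z t = 0) →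
      (z : V₁ × V₂) ∈ AddSubgroup.zmultiples S.toVisibleSplit.x := by
    intro z hz
    -- test against `(t₁, 0)` and `(0, t₂)`
    have h1 : ∀ t₁ : S.Sel₁, P₁ (S.fstSel z) t₁ = 0 := by
      intro t₁
      have h := hz ⟨((t₁ : V₁), 0), AddSubgroup.mem_prod.mpr ⟨t₁.2, S.Sel₂.zero_mem⟩⟩
      rw [hP, prodPairing_apply'] at h
      have hs : S.sndSel ⟨((t₁ : V₁), (0 : V₂)), AddSubgroup.mem_prod.mpr ⟨t₁.2, S.Sel₂.zero_mem⟩⟩ = 0 :=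
        Subtype.ext rfl
      have hf : S.fstSel ⟨((t₁ : V₁), (0 : V₂)), AddSubgroup.mem_prod.mpr ⟨t₁.2, S.Sel₂.zero_mem⟩⟩ = t₁ :=
        Subtype.ext rfl
      rwa [hs, hf, map_zero, add_zero] at h
    have h2 : ∀ t₂ : S.Sel₂, P₂ (S.sndSel z) t₂ = 0 := by
      intro t₂
      have h := hz ⟨((0 : V₁), (t₂ : V₂)), AddSubgroup.mem_prod.mpr ⟨S.Sel₁.zero_mem, t₂.2⟩⟩
      rw [hP, prodPairing_apply'] at h
      have hf : S.fstSel ⟨((0 : V₁), (t₂ : V₂)), AddSubgroup.mem_prod.mpr ⟨S.Sel₁.zero_mem, t₂.2⟩⟩ = 0 :=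
        Subtype.ext rfl
      have hs : S.sndSel ⟨((0 : V₁), (t₂ : V₂)), AddSubgroup.mem_prod.mpr ⟨S.Sel₁.zero_mem, t₂.2⟩⟩ = t₂ :=
        Subtype.ext rfl
      rwa [hf, hs, map_zero, zero_add] at h
    obtain ⟨k, hk⟩ := AddSubgroup.mem_zmultiples_iff.mp (hnd₁ _ h1)
    have hz2 : (S.sndSel z : V₂) = 0 := congrArg Subtype.val (hnd₂ _ h2)
    refine AddSubgroup.mem_zmultiples_iff.mpr ⟨k, ?_⟩
    change k • (S.x, (0 : V₂)) = (z : V₁ × V₂)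
    refine Prod.ext ?_ ?_
    · exact hk
    · change k • (0 : V₂) = (z : V₁ × V₂).2
      rw [smul_zero]
      exact hz2.symm
  -- Kolyvagin's classes of the pair are supported on Kolyvagin places (Lemma 4.3)
  have hcsupp : ∀ n, KolSupp S.Kol n → ∀ v, (∀ q, S.Kol q → v ≠ S.pl q) →
      S.toVisibleSplit.c n ∈ S.toVisibleSplit.Loc v := by
    intro n hn v hv
    change pairClass S.c₁ S.c₂ n ∈ (S.Loc₁ v).prod (S.Loc₂ v)
    rcases Nat.even_or_odd n.primeFactors.card with h | h
    · simp only [pairClass, h, if_true]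
      exact AddSubgroup.mem_prod.mpr ⟨hcsupp₁ n hn h v hv, zero_mem _⟩
    · have h' : ¬ Even n.primeFactors.card := Nat.not_even_iff_odd.mpr h
      simp only [pairClass, h', if_false]
      exact AddSubgroup.mem_prod.mpr ⟨zero_mem _, hcsupp₂ n hn h v hv⟩
  -- the visible Čebotarev in split currency
  have hCeb' : ∀ (T : Finset (V₁ × V₂)) (g₁ g₂ : V₁ × V₂) (ν : ℤ), (ν = 1 ∨ ν = -1) →
      g₁ ∈ S.toVisibleSplit.part ν → g₂ ∈ S.toVisibleSplit.part (-ν) →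
      (∀ t ∈ T, ∃ e : ℤ, (e = 1 ∨ e = -1) ∧ t ∈ S.toVisibleSplit.part e) →
      (∀ g ∈ AddSubgroup.closure (insert g₁ (insert g₂ (T : Set (V₁ × V₂)))),
        S.toVisibleSplit.rK g = 0 → g = 0) →
      ∀ b : ℕ, ∃ ℓ, b < ℓ ∧ S.toVisibleSplit.Kol ℓ ∧ (∀ t ∈ T, t ∈ S.toVisibleSplit.A ℓ) ∧
        (∀ j : ℕ, ((S.toVisibleSplit.p : ℤ) ^ j) • g₁ ∈ S.toVisibleSplit.A ℓ ↔
          ((S.toVisibleSplit.p : ℤ) ^ j) • g₁ ∈ AddSubgroup.closure (T : Set (V₁ × V₂))) ∧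
        (∀ j : ℕ, ((S.toVisibleSplit.p : ℤ) ^ j) • g₂ ∈ S.toVisibleSplit.A ℓ ↔
          ((S.toVisibleSplit.p : ℤ) ^ j) • g₂ ∈ AddSubgroup.closure (T : Set (V₁ × V₂))) :=
    fun T g₁ g₂ ν hν h₁ h₂ hT hvis b ↦ hCeb T g₁ g₂ ν hν h₁ h₂ hT (fun g hg h0 ↦ hvis g hg h0) b
  -- the split exactness theorem
  have hc₀' : ((S.toVisibleSplit.p : ℤ) ^ (S.toVisibleSplit.M - 1)) • S.toVisibleSplit.c ℓ₀ ≠ 0 := by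
    have hodd : Odd ℓ₀.primeFactors.card := by
      rw [card_primeFactors_prime (S.prime_of_kol ℓ₀ hℓ₀)]; exact odd_one
    have hne : ¬ Even ℓ₀.primeFactors.card := Nat.not_even_iff_odd.mpr hodd
    change ((S.p : ℤ) ^ (S.M - 1)) • pairClass S.c₁ S.c₂ ℓ₀ ≠ 0
    simp only [pairClass, hne, if_false]
    intro h
    exact hc₀ (by simpa using congrArg Prod.snd h)
  obtain ⟨hcard, hε⟩ := S.toVisibleSplit.card_sel_eq_of_primitive_of_le_of_torsion P halt hPcross hPx' hnd hCTV
    hCeb' hcsupp h3 hℓ₀ hc₀'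
  -- read back: `Sel₁ = ℤx`
  have hSel₁ : S.Sel₁ = AddSubgroup.zmultiples S.x := by
    refine le_antisymm (fun s hs ↦ ?_) (AddSubgroup.zmultiples_le_of_mem S.x_mem)
    have hmem : ((s, (0 : V₂)) : V₁ × V₂) ∈ S.toVisibleSplit.Sel :=
      AddSubgroup.mem_prod.mpr ⟨hs, S.Sel₂.zero_mem⟩
    have h := hε (s, 0) hmem (S.mem_part_one'.mpr rfl)
    obtain ⟨k, hk⟩ := AddSubgroup.mem_zmultiples_iff.mp h
    exact AddSubgroup.mem_zmultiples_iff.mpr ⟨k, congrArg Prod.fst hk⟩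
  refine ⟨hSel₁, ?_⟩
  -- and `#Sel₂ = p^{2M₀}` from `#Sel = p^M · p^{2M₀}`, `#Sel₁ = p^M`
  have hcard₁ : Nat.card S.Sel₁ = S.p ^ S.M := by
    rw [hSel₁, Nat.card_zmultiples, addOrderOf_eq_prime_pow S.hp (S.torsion₁ S.x) S.x_ord]
  have hprod : Nat.card S.toVisibleSplit.Sel = Nat.card S.Sel₁ * Nat.card S.Sel₂ := by
    change Nat.card (S.Sel₁.prod S.Sel₂) = _
    rw [Nat.card_congr (AddSubgroup.prodEquiv S.Sel₁ S.Sel₂).toEquiv, Nat.card_prod]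
  have hppos : 0 < S.p ^ S.M := pow_pos S.hp.pos _
  have h := hcard
  rw [hprod, hcard₁] at h
  exact Nat.eq_of_mul_eq_mul_left hppos h

end VisiblePairHypothesesM

end KolyvaginDescent

end Literature.NumberTheory.EllipticCurves
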